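import Summits.ValiantsHypothesis.ValiantsHypothesis.Theorems.NewtonUnitEquationsTwoProductsExpBlockTensorFrames

/-!
# K10 `exp-block-tensorisation` — truncated exponentials: low-degree multiplicativity `E_N(x+y) ≡ E_N(x)·E_N(y)` and the block splitting of a tail

Tool file for L1 `ExpTensorCoeff` (K10c).  For polynomials without constant term, the truncated exponential `truncExp N` (the K10 object) is
multiplicative UP TO TOTAL DEGREE `N`: `LowEq N (truncExp N (x + y)) (truncExp N x * truncExp N y)` (binomial theorem; the discrepancy
`Σ_{a,c ≤ N, a+c > N} x^a y^c/(a! c!)` has order `> N`), hence `∏_B truncExp N (q_B) ≡ truncExp N (Σ_B q_B)` below degree `N` for any finite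
family; and a tail is the sum of its block restrictions (`sum_restrictBlock`).  Vocabulary: `HasOrder a P` (every monomial of `P` has total degree
`≥ a`), `LowEq N P Q` (equal coefficients in total degree `≤ N`), total degree = `Finsupp.degree`.
Helper mode (`--supports stmt-ValiantsHypothesis-5906 --as helper`).  Honest framing: algebraic bookkeeping; nothing here closes 5906 or 5905; VP ≠ VNP
is NOT proved.  No instances, no notation, no named facts. [folklore]
-/

noncomputable section
set_option linter.dupNamespace false

namespace Summit.ValiantsHypothesis.ValiantsHypothesis.Theorems.NewtonUnitEquations.TwoProducts.ExpBlock

open MvPolynomial Finset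
open Summit.ValiantsHypothesis.ValiantsHypothesis.Theorems.NewtonUnitEquations.TwoProducts.FormalLogLinearisation
open Summit.ValiantsHypothesis.ValiantsHypothesis.Theorems.NewtonUnitEquations.TwoProducts.PlanarCell

variable {m b : ℕ}

/-! ## Order and low-degree congruence -/

/-- Total degree of a bivariate exponent: `degree n = n₀ + n₁`. [folklore] -/
theorem degree_fin_two (n : Expo) : n.degree = n 0 + n 1 := by
  rw [Finsupp.degree_eq_sum, Fin.sum_univ_two]

/-- `P` has ORDER at least `a`: every monomial of `P` has total degree `≥ a`. [folklore] -/
def HasOrder (a : ℕ) (P : MvPolynomial (Fin 2) ℂ) : Prop := ∀ n ∈ P.support, a ≤ n.degree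

/-- Everything has order `≥ 0`. [folklore] -/
theorem hasOrder_zero (P : MvPolynomial (Fin 2) ℂ) : HasOrder 0 P := fun _ _ => Nat.zero_le _

/-- Order is monotone. [folklore] -/
theorem HasOrder.mono {a a' : ℕ} {P : MvPolynomial (Fin 2) ℂ} (h : HasOrder a P) (ha : a' ≤ a) : HasOrder a' P :=
  fun n hn => ha.trans (h n hn)

/-- Orders add under multiplication. [folklore] -/
theorem HasOrder.mul {a c : ℕ} {P Q : MvPolynomial (Fin 2) ℂ} (hP : HasOrder a P) (hQ : HasOrder c Q) :
    HasOrder (a + c) (P * Q) := by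
  classical
  intro n hn
  obtain ⟨p, hp, q, hq, rfl⟩ := Finset.mem_add.1 (support_mul P Q hn)
  rw [map_add]
  exact add_le_add (hP p hp) (hQ q hq)

/-- Order is preserved by sums. [folklore] -/
theorem HasOrder.add {a : ℕ} {P Q : MvPolynomial (Fin 2) ℂ} (hP : HasOrder a P) (hQ : HasOrder a Q) : HasOrder a (P + Q) := by
  intro n hn
  rcases Finset.mem_union.1 (support_add hn) with h | h
  · exact hP n h
  · exact hQ n h

/-- Order is preserved by subtraction. [folklore] -/
theorem HasOrder.sub {a : ℕ} {P Q : MvPolynomial (Fin 2) ℂ} (hP : HasOrder a P) (hQ : HasOrder a Q) : HasOrder a (P - Q) := by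
  intro n hn
  rcases Finset.mem_union.1 (support_sub _ P Q hn) with h | h
  · exact hP n h
  · exact hQ n h

/-- Order is preserved by scalars. [folklore] -/
theorem HasOrder.smul {a : ℕ} {P : MvPolynomial (Fin 2) ℂ} (hP : HasOrder a P) (c : ℂ) : HasOrder a (c • P) :=
  fun n hn => hP n (support_smul hn)

/-- Order is preserved by finite sums. [folklore] -/
theorem hasOrder_sum {ι : Type*} {a : ℕ} (s : Finset ι) (f : ι → MvPolynomial (Fin 2) ℂ) (h : ∀ i ∈ s, HasOrder a (f i)) :
    HasOrder a (∑ i ∈ s, f i) := by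
  classical
  induction s using Finset.induction_on with
  | empty => intro n hn; simp at hn
  | insert i s hi ih =>
    rw [Finset.sum_insert hi]
    exact (h i (Finset.mem_insert_self i s)).add (ih fun j hj => h j (Finset.mem_insert_of_mem hj))

/-- A polynomial without constant term has order `≥ 1`. [folklore] -/
theorem hasOrder_one_of_coeff_zero {x : MvPolynomial (Fin 2) ℂ} (hx : coeff 0 x = 0) : HasOrder 1 x := by
  intro n hn
  rw [Nat.one_le_iff_ne_zero, Ne, Finsupp.degree_eq_zero_iff]
  rintro rfl
  exact (mem_support_iff.1 hn) hx

/-- Powers of a polynomial without constant term: `x^a` has order `≥ a`. [folklore] -/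
theorem hasOrder_pow {x : MvPolynomial (Fin 2) ℂ} (hx : coeff 0 x = 0) (a : ℕ) : HasOrder a (x ^ a) := by
  induction a with
  | zero => exact hasOrder_zero _
  | succ a ih =>
    rw [pow_succ]
    exact ih.mul (hasOrder_one_of_coeff_zero hx)

/-- LOW-DEGREE CONGRUENCE: equal coefficients in total degree `≤ N`. [folklore] -/
def LowEq (N : ℕ) (P Q : MvPolynomial (Fin 2) ℂ) : Prop := ∀ n : Expo, n.degree ≤ N → coeff n P = coeff n Q

/-- Reflexivity. [folklore] -/
theorem lowEq_refl {N : ℕ} (P : MvPolynomial (Fin 2) ℂ) : LowEq N P P := fun _ _ => Eq.refl _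

/-- Symmetry. [folklore] -/
theorem LowEq.symm {N : ℕ} {P Q : MvPolynomial (Fin 2) ℂ} (h : LowEq N P Q) : LowEq N Q P := fun n hn => (h n hn).symm

/-- Transitivity. [folklore] -/
theorem LowEq.trans {N : ℕ} {P Q T : MvPolynomial (Fin 2) ℂ} (h : LowEq N P Q) (h' : LowEq N Q T) : LowEq N P T :=
  fun n hn => (h n hn).trans (h' n hn)

/-- A difference of order `> N` is a low-degree congruence. [folklore] -/
theorem lowEq_of_hasOrder {N : ℕ} {P Q : MvPolynomial (Fin 2) ℂ} (h : HasOrder (N + 1) (P - Q)) : LowEq N P Q := by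
  intro n hn
  by_contra hne
  have hmem : n ∈ (P - Q).support := by
    rw [mem_support_iff, coeff_sub]
    exact sub_ne_zero.2 hne
  have := h n hmem
  omega

/-- Conversely, a low-degree congruence is a difference of order `> N`. [folklore] -/
theorem LowEq.hasOrder {N : ℕ} {P Q : MvPolynomial (Fin 2) ℂ} (h : LowEq N P Q) : HasOrder (N + 1) (P - Q) := by
  intro n hn
  by_contra hlt
  push Not at hlt
  have := h n (by omega)
  rw [mem_support_iff, coeff_sub, this, sub_self] at hn
  exact hn rfl

/-- Congruences multiply on the left. [folklore] -/
theorem LowEq.mul_left {N : ℕ} {P Q : MvPolynomial (Fin 2) ℂ} (h : LowEq N P Q) (T : MvPolynomial (Fin 2) ℂ) :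
    LowEq N (T * P) (T * Q) := by
  refine lowEq_of_hasOrder ?_
  rw [← mul_sub]
  have := (hasOrder_zero T).mul h.hasOrder
  simpa using this

/-! ## Truncated exponentials -/

/-- `E_N(0) = 1`. [folklore] -/
theorem truncExp_zero (N : ℕ) : truncExp N (0 : MvPolynomial (Fin 2) ℂ) = 1 := by
  unfold truncExp
  rw [Finset.sum_eq_single 0]
  · simp
  · intro r _ hr
    rw [zero_pow hr, smul_zero]
  · intro h
    exact absurd (Finset.mem_range.2 (Nat.succ_pos N)) h

/-- The constant term of `E_N(x)` is `1` when `x` has none. [folklore] -/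
theorem coeff_zero_truncExp (N : ℕ) {x : MvPolynomial (Fin 2) ℂ} (hx : coeff 0 x = 0) : coeff 0 (truncExp N x) = 1 := by
  classical
  unfold truncExp
  rw [coeff_sum, Finset.sum_eq_single 0]
  · simp
  · intro r _ hr
    rw [coeff_smul]
    have : coeff 0 (x ^ r) = 0 := by
      have h := hasOrder_pow hx r
      by_contra hne
      have := h 0 (mem_support_iff.2 hne)
      simp at this
      exact hr this
    rw [this, smul_zero]
  · intro h
    exact absurd (Finset.mem_range.2 (Nat.succ_pos N)) h

/-- The double-sum form of `E_N(x) · E_N(y)`. [folklore] -/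
theorem truncExp_mul_truncExp (N : ℕ) (x y : MvPolynomial (Fin 2) ℂ) :
    truncExp N x * truncExp N y =
      ∑ a ∈ Finset.range (N + 1), ∑ c ∈ Finset.range (N + 1),
        (((Nat.factorial a : ℂ)⁻¹ * ((Nat.factorial c : ℂ)⁻¹)) • (x ^ a * y ^ c)) := by
  unfold truncExp
  rw [Finset.sum_mul_sum]
  refine Finset.sum_congr rfl fun a _ => Finset.sum_congr rfl fun c _ => ?_
  rw [smul_mul_smul_comm]

/-- The binomial expansion of `E_N(x+y)` as a double sum over `a + c ≤ N`. [folklore] -/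
theorem truncExp_add_eq (N : ℕ) (x y : MvPolynomial (Fin 2) ℂ) :
    truncExp N (x + y) =
      ∑ a ∈ Finset.range (N + 1), ∑ c ∈ Finset.range (N + 1),
        if a + c ≤ N then (((Nat.factorial a : ℂ)⁻¹ * ((Nat.factorial c : ℂ)⁻¹)) • (x ^ a * y ^ c)) else 0 := by
  classical
  unfold truncExp
  -- each `(x+y)^r / r!` is the antidiagonal sum of `x^a y^c / (a! c!)`
  have hr : ∀ r : ℕ, ((Nat.factorial r : ℂ)⁻¹) • (x + y) ^ r =
      ∑ ac ∈ antidiagonal r, (((Nat.factorial ac.1 : ℂ)⁻¹ * ((Nat.factorial ac.2 : ℂ)⁻¹)) • (x ^ ac.1 * y ^ ac.2)) := by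
    intro r
    rw [(Commute.all x y).add_pow' r, Finset.smul_sum]
    refine Finset.sum_congr rfl fun ac hac => ?_
    have hsum : ac.1 + ac.2 = r := HasAntidiagonal.mem_antidiagonal.1 hac
    rw [← Nat.cast_smul_eq_nsmul ℂ (r.choose ac.1), smul_smul]
    congr 1
    have hfact : (r.choose ac.1 : ℂ) * (Nat.factorial ac.1 : ℂ) * (Nat.factorial ac.2 : ℂ) = (Nat.factorial r : ℂ) := by
      have h := Nat.choose_mul_factorial_mul_factorial (show ac.1 ≤ r by omega)
      rw [show r - ac.1 = ac.2 by omega] at h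
      exact_mod_cast h
    have h1 : (Nat.factorial ac.1 : ℂ) ≠ 0 := by exact_mod_cast (Nat.factorial_pos _).ne'
    have h2 : (Nat.factorial ac.2 : ℂ) ≠ 0 := by exact_mod_cast (Nat.factorial_pos _).ne'
    have h3 : (Nat.factorial r : ℂ) ≠ 0 := by exact_mod_cast (Nat.factorial_pos _).ne'
    field_simp
    linear_combination hfact
  simp_rw [hr]
  -- regroup the pairs `(a, c)` with `a + c ≤ N`
  rw [← Finset.sum_biUnion]
  · have hset : (Finset.range (N + 1)).biUnion (fun r => antidiagonal r) =
        (Finset.range (N + 1) ×ˢ Finset.range (N + 1)).filter (fun ac : ℕ × ℕ => ac.1 + ac.2 ≤ N) := by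
      ext ac
      simp only [Finset.mem_biUnion, Finset.mem_range, HasAntidiagonal.mem_antidiagonal, Finset.mem_filter, Finset.mem_product]
      constructor
      · rintro ⟨r, hr, hac⟩; omega
      · rintro ⟨⟨h1, h2⟩, h3⟩; exact ⟨ac.1 + ac.2, by omega, rfl⟩
    rw [hset, Finset.sum_filter, Finset.sum_product]
  · -- the antidiagonals are pairwise disjoint
    intro r _ r' _ hne
    refine Finset.disjoint_left.2 fun ac h1 h2 => hne ?_
    rw [HasAntidiagonal.mem_antidiagonal] at h1 h2
    omega

/-- **Low-degree multiplicativity of the truncated exponential.** [folklore] -/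
theorem lowEq_truncExp_add (N : ℕ) {x y : MvPolynomial (Fin 2) ℂ} (hx : coeff 0 x = 0) (hy : coeff 0 y = 0) :
    LowEq N (truncExp N (x + y)) (truncExp N x * truncExp N y) := by
  classical
  intro n hn
  rw [truncExp_add_eq, truncExp_mul_truncExp, coeff_sum, coeff_sum]
  refine Finset.sum_congr rfl fun a _ => ?_
  rw [coeff_sum, coeff_sum]
  refine Finset.sum_congr rfl fun c _ => ?_
  split_ifs with hac
  · rfl
  · -- the term `x^a y^c` has order `a + c > N ≥ deg n`
    rw [coeff_zero, coeff_smul]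
    have hord : HasOrder (a + c) (x ^ a * y ^ c) := (hasOrder_pow hx a).mul (hasOrder_pow hy c)
    have : coeff n (x ^ a * y ^ c) = 0 := by
      by_contra hne
      have := hord n (mem_support_iff.2 hne)
      omega
    rw [this, smul_zero]

/-- A finite sum of polynomials without constant term has none. [folklore] -/
theorem coeff_zero_sum_eq_zero {ι : Type*} (s : Finset ι) (q : ι → MvPolynomial (Fin 2) ℂ) (h : ∀ i ∈ s, coeff 0 (q i) = 0) :
    coeff 0 (∑ i ∈ s, q i) = 0 := by
  rw [coeff_sum]
  exact Finset.sum_eq_zero h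

/-- **Product of truncated exponentials ≡ truncated exponential of the sum, below degree `N`.** [folklore] -/
theorem lowEq_prod_truncExp {ι : Type*} (N : ℕ) (s : Finset ι) (q : ι → MvPolynomial (Fin 2) ℂ)
    (hq : ∀ i ∈ s, coeff 0 (q i) = 0) : LowEq N (∏ i ∈ s, truncExp N (q i)) (truncExp N (∑ i ∈ s, q i)) := by
  classical
  induction s using Finset.induction_on with
  | empty =>
    rw [Finset.prod_empty, Finset.sum_empty, truncExp_zero]
    exact lowEq_refl _
  | insert i s hi ih =>
    rw [Finset.prod_insert hi, Finset.sum_insert hi]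
    have h1 : LowEq N (truncExp N (q i) * ∏ j ∈ s, truncExp N (q j)) (truncExp N (q i) * truncExp N (∑ j ∈ s, q j)) :=
      (ih fun j hj => hq j (Finset.mem_insert_of_mem hj)).mul_left _
    have h2 : LowEq N (truncExp N (q i + ∑ j ∈ s, q j)) (truncExp N (q i) * truncExp N (∑ j ∈ s, q j)) :=
      lowEq_truncExp_add N (hq i (Finset.mem_insert_self i s))
        (coeff_zero_sum_eq_zero s q fun j hj => hq j (Finset.mem_insert_of_mem hj))
    exact h1.trans h2.symm

/-! ## A tail is the sum of its block restrictions -/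

/-- Coefficients of a block restriction. [folklore] -/
theorem coeff_restrictBlock (blk : Expo → Fin b) (B : Fin b) (q : MvPolynomial (Fin 2) ℂ) (n : Expo) :
    coeff n (restrictBlock blk B q) = if blk n = B then coeff n q else 0 := by
  classical
  unfold restrictBlock
  rw [coeff_sum]
  simp only [coeff_monomial]
  rw [Finset.sum_ite_eq']
  by_cases hn : n ∈ q.support
  · simp [Finset.mem_filter, hn]
  · have h0 : coeff n q = 0 := notMem_support_iff.1 hn
    simp [Finset.mem_filter, hn, h0]

/-- A block restriction has no constant term if the polynomial has none. [folklore] -/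
theorem coeff_zero_restrictBlock (blk : Expo → Fin b) (B : Fin b) {q : MvPolynomial (Fin 2) ℂ} (hq : coeff 0 q = 0) :
    coeff 0 (restrictBlock blk B q) = 0 := by
  rw [coeff_restrictBlock]
  split_ifs <;> simp [hq]

/-- **A polynomial is the sum of its block restrictions.** [folklore] -/
theorem sum_restrictBlock (blk : Expo → Fin b) (q : MvPolynomial (Fin 2) ℂ) : ∑ B, restrictBlock blk B q = q := by
  classical
  ext n
  rw [coeff_sum]
  simp only [coeff_restrictBlock]
  rw [Finset.sum_ite_eq]
  simp

end Summit.ValiantsHypothesis.ValiantsHypothesis.Theorems.NewtonUnitEquations.TwoProducts.ExpBlock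

end
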